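import Summits.CriticalPhenomena.SAWScalingLimit.Theses.SAWTargetMonotonicity
import Summits.CriticalPhenomena.SAWScalingLimit.Theorems.SAWRenewalTightnessTightIdentificationGlue

/-!
# `SAWTargetMonotonicity.Assembly` (stmt-CriticalPhenomena-8257): the Prokhorov glue of the route

Closes the assembly item of route `SAWTargetMonotonicity` ("the polymer aims") of the sub-problem
`SAWScalingLimit`:

  `Assembly := TargetMonotone → DomainMonotone → MonotoneRSW → TraversalBoundTight →
    SubseqIdentification → SAWScalingLimit`.

Proof (`sawTargetMonotonicity_assembly_proof`), pure logic plus the tree's proved reductions,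
exactly as for route `SAWLeftRightFKG` (`SAWLeftRightFKGAssembly.lean`): the one-curve RSW engine
`MonotoneRSW` applied to the two monotone couplings `TargetMonotone` and `DomainMonotone` is
`SAWTraversalBound` (the Aizenman–Burchard hypothesis (H1) for the critical square-lattice SAW;
the conclusion of `MonotoneRSW` is the body of `SAWTraversalBound`, definitionally), and
`TraversalBoundTight` turns it into `EventualTight`, i.e. tightness along the mesh
(`IsTightAlongMesh`) of the pushed critical SAW laws for every Dobrushin domain and endpoint
approximation. `SubseqIdentification`, read through `IsSubseqLimitLaw`, identifies every
subsequential weak limit law which is a probability measure as the chordal SLE_{8/3} law, and the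
tree's PROVED soft half `saw_convergesInLawToSLE_of_isTightAlongMesh`
(`SAWRenewalTightnessTightIdentificationGlue.lean`: Prokhorov's theorem + the subsequence
principle along `𝓝[>] 0` + uniqueness of the chordal SLE law; the SAW laws are probability
measures for all small `δ` because `a δ, b δ` are joined in the finite `Ω_δ`, and the curve
observable is measurable for the discrete σ-algebra) gives `ConvergesInLawToSLE (8/3) D` for the
SAW curve laws, which is `SAWScalingLimit = Literature.Probability.RandomPlanarGeometry.SAW.SAWScalingLimit`
unfolded. No named fact is used; axioms are the standard three.

References: P. Billingsley, *Convergence of Probability Measures*, 2nd ed. (1999), Thm. 5.1 and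
its Corollary [BillingsleyCPM1999]; H. Duminil-Copin, S. Smirnov, *Conformal invariance of
lattice models* (2012), proof of Thm. 3.13.
-/

noncomputable section

namespace Summit.CriticalPhenomena.SAWScalingLimit.Theorems

open MeasureTheory Filter Topology Set
open Literature.Probability.RandomPlanarGeometry Literature.Probability.LatticeModels
open scoped ENNReal NNReal

/-- **Assembly of route SAWTargetMonotonicity** (item stmt-CriticalPhenomena-8257):
`TargetMonotone → DomainMonotone → MonotoneRSW → TraversalBoundTight → SubseqIdentification →
SAWScalingLimit`. Modus ponens twice (`MonotoneRSW` on the two monotone couplings gives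
`SAWTraversalBound`, `TraversalBoundTight` gives `EventualTight`), then for each `(D, a, b)` with
`IsEndpointApprox` the SAW convergence criterion `saw_convergesInLawToSLE_of_isTightAlongMesh`
(Prokhorov + subsequence principle + uniqueness of the SLE_{8/3} law) with the subsequential limit
laws identified by `SubseqIdentification` yields convergence in law to chordal SLE_{8/3}, i.e.
`SAWScalingLimit`. [cite: BillingsleyCPM1999, Thm. 5.1, Corollary] -/
theorem sawTargetMonotonicity_assembly_proof :
    Summit.CriticalPhenomena.SAWScalingLimit.Theses.SAWTargetMonotonicity.Assembly := by
  unfold Summit.CriticalPhenomena.SAWScalingLimit.Theses.SAWTargetMonotonicity.Assembly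
  intro hTM hDM hRSW hTBT hId D a b hab
  have hTrav : Theses.SAWTargetMonotonicity.SAWTraversalBound := hRSW hTM hDM
  have hT : Theses.SAWTargetMonotonicity.EventualTight := hTBT hTrav
  refine saw_convergesInLawToSLE_of_isTightAlongMesh hab (hT D a b hab) ?_
  rintro μ hμ ⟨s, hs, hlim⟩
  exact hId D a b hab s μ hs hμ hlim

end Summit.CriticalPhenomena.SAWScalingLimit.Theorems

end
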